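import Literature.Analysis.FluidPDE.LerayHopfTimeSliceTorus
import HarnessLib

/-!
# The momentum (spatial-mean) balance of forced weak solutions on the flat torus, a.e. in time

Analysis/FluidPDE proof file (theorems only). For a forced weak (pressure-free) solution `u` of
Navier–Stokes on `T^d × [0,T)` in the sense of the accepted `Torus.IsWeakNSSolutionForcedOn` — the bare
space–time formulation, NO weak continuity in time, slices only almost everywhere in `L²` — with a force
`f ∈ C([0,T];L²)` and `u ∈ L^∞(0,T;L²)`, testing with the constant fields `ψ(s,x) = η(s) e` (divergence
free; `(u·∇)e = 0`, `Δe = 0`) and the du Bois-Reymond lemma with initial datum give the momentum balance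

`∫ ⟪u(t), e⟫ = ∫ ⟪u₀, e⟫ + ∫₀ᵗ ∫ ⟪f(s), e⟫ ds` for almost every `t ∈ (0,T)`

(`IsWeakNSSolutionForcedOn.integral_inner_const_eq_ae`; Temam 1984 Ch. III §1.1 (1.22)⇔(1.25) with
Lemma 1.1, tested with constants; Galdi 2000 Lemma 2.1). For Leray–Hopf solutions (weakly continuous) the
tree has the EVERY-`t` form with general smooth tests (`IsLerayHopfOn.integral_inner_eq_add_setIntegral`);
the point here is the minimal class — the one in which claim skeletons of the cell `ns-claims` type «mean
identities» (e.g. `Literature.Claims.NS.Davlatov2020.Identity62`, (6.2) p.14), which therefore hold almost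
everywhere in time and for every representative only in that sense.

WHAT THIS IS NOT: not a claim about NS regularity or blow-up; not a claim about any author beyond the
typed locator.

## References
* R. Temam, *Navier–Stokes Equations*, North-Holland 1984, Ch. III §1.1, (1.22)–(1.25), Lemma 1.1. [Temam1984]
* G. P. Galdi, in: *Fundamental directions in mathematical fluid mechanics*, Birkhäuser 2000, Lemma 2.1. [Galdi2000]
-/

noncomputable section

open MeasureTheory TopologicalSpace Set Function Filter Topology InnerProductSpace
open scoped RealInnerProductSpace ENNReal NNReal ContDiff

namespace Literature.Analysis.FluidPDE.Torus

variable {d : Type*} [Fintype d] [DecidableEq d]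

/-! ### Constant test fields -/

/-- Constant fields are divergence free on the torus. [folklore] -/
private theorem isDivFree_constField (c : EuclideanSpace ℝ d) :
    FunctionSpaces.Torus.IsDivFree (fun _ : UnitAddTorus d => c) := by
  intro x
  simp [FunctionSpaces.Torus.divergence, FunctionSpaces.Torus.partialDeriv, FunctionSpaces.Torus.lineDeriv]

omit [DecidableEq d] in
/-- `(u·∇)c = 0` for a constant field `c`. [folklore] -/
private theorem convect_constField_zero (u : UnitAddTorus d → EuclideanSpace ℝ d) (c : EuclideanSpace ℝ d)
    (x : UnitAddTorus d) : FunctionSpaces.Torus.convect u (fun _ : UnitAddTorus d => c) x = 0 := by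
  have h : FunctionSpaces.Torus.liftAt (fun _ : UnitAddTorus d => c) x = fun _ => c := by
    funext v; simp [FunctionSpaces.Torus.liftAt_apply]
  simp [FunctionSpaces.Torus.convect, FunctionSpaces.Torus.fderiv, h]

omit [DecidableEq d] in
/-- `Δc = 0` for a constant field `c`. [folklore] -/
private theorem laplacian_constField_zero (c : EuclideanSpace ℝ d) (x : UnitAddTorus d) :
    FunctionSpaces.Torus.laplacian (fun _ : UnitAddTorus d => c) x = 0 := by
  have h : FunctionSpaces.Torus.liftAt (fun _ : UnitAddTorus d => c) x = fun _ => c := by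
    funext v; simp [FunctionSpaces.Torus.liftAt_apply]
  rw [FunctionSpaces.Torus.laplacian, h]
  exact congrFun (InnerProductSpace.laplacian_const (E := EuclideanSpace ℝ d) (c := c)) 0

/-! ### The space–time formulation tested with a product field, a.e.-slice hypotheses -/

variable {T ν : ℝ} {f u : ℝ → UnitAddTorus d → EuclideanSpace ℝ d}
  {u₀ : UnitAddTorus d → EuclideanSpace ℝ d}

/-- `IsWeakNSSolutionForcedOn.test_smul` with the slice hypotheses weakened to «for a.e. `s`»:
testing the space–time weak formulation with `η(s)Ψ(x)` gives
`∫_{(0,T)} (η' ⟨u,Ψ⟩ + η ∫(⟪u,(u·∇)Ψ⟫ + ν⟪u,ΔΨ⟫ + ⟪f,Ψ⟫)) + η(0)⟨u₀,Ψ⟩ = 0` (Temam 1984, Ch. III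
(1.22)–(1.24)). [cite: Temam1984, Ch. III §1.1 (1.22)–(1.24)] -/
theorem IsWeakNSSolutionForcedOn.test_smul_ae (hu : IsWeakNSSolutionForcedOn T ν f u₀ u)
    (hL2 : ∀ᵐ s ∂(volume.restrict (Ioo 0 T)), MemLp (u s) 2 volume)
    (hfL1 : ∀ᵐ s ∂(volume.restrict (Ioo 0 T)), Integrable (f s) volume)
    {Ψ : UnitAddTorus d → EuclideanSpace ℝ d} (hΨ : FunctionSpaces.Torus.IsSmooth Ψ)
    (hΨdiv : FunctionSpaces.Torus.IsDivFree Ψ)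
    {η : ℝ → ℝ} (hη : ContDiff ℝ ∞ η) (hηc : HasCompactSupport η) (hηT : tsupport η ⊆ Iio T) :
    (∫ s in Ioo 0 T, ((deriv η s * ∫ x, ⟪u s x, Ψ x⟫) +
        η s * ∫ x, (⟪u s x, FunctionSpaces.Torus.convect (u s) Ψ x⟫ +
          ν * ⟪u s x, FunctionSpaces.Torus.laplacian Ψ x⟫ + ⟪f s x, Ψ x⟫))) +
      η 0 * ∫ x, ⟪u₀ x, Ψ x⟫ = 0 := by
  obtain ⟨-, -, -, hweak⟩ := hu
  have hηd : Differentiable ℝ η := hη.differentiable (by simp)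
  have key := hweak (fun s x => η s • Ψ x) (isSpaceTimeTest_smul hη hηc hηT hΨ)
    (isDivFreeTest_smul η hΨdiv)
  have hinit : ∫ x, ⟪u₀ x, η 0 • Ψ x⟫ = η 0 * ∫ x, ⟪u₀ x, Ψ x⟫ := by
    simp only [real_inner_smul_right]
    exact integral_const_mul _ _
  have hslice : ∀ᵐ s ∂(volume.restrict (Ioo 0 T)),
      ∫ x, (⟪u s x, FunctionSpaces.Torus.timeDeriv (fun s x => η s • Ψ x) s x⟫ +
        ⟪u s x, FunctionSpaces.Torus.convect (u s) (fun x => η s • Ψ x) x⟫ +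
        ν * ⟪u s x, FunctionSpaces.Torus.laplacian (fun x => η s • Ψ x) x⟫ + ⟪f s x, η s • Ψ x⟫) =
      (deriv η s * ∫ x, ⟪u s x, Ψ x⟫) +
        η s * ∫ x, (⟪u s x, FunctionSpaces.Torus.convect (u s) Ψ x⟫ +
          ν * ⟪u s x, FunctionSpaces.Torus.laplacian Ψ x⟫ + ⟪f s x, Ψ x⟫) := by
    filter_upwards [hfL1, hL2] with s hfs hus
    have i1 : Integrable (fun x => ⟪u s x, Ψ x⟫) volume :=
      FunctionSpaces.Torus.integrable_inner_of_continuous (hus.integrable one_le_two) hΨ.continuous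
    have i2 := integrable_nsFluxIntegrand hus hfs hΨ ν
    have hpt : (fun x => ⟪u s x, FunctionSpaces.Torus.timeDeriv (fun s x => η s • Ψ x) s x⟫ +
        ⟪u s x, FunctionSpaces.Torus.convect (u s) (fun x => η s • Ψ x) x⟫ +
        ν * ⟪u s x, FunctionSpaces.Torus.laplacian (fun x => η s • Ψ x) x⟫ + ⟪f s x, η s • Ψ x⟫) =
        fun x => deriv η s * ⟪u s x, Ψ x⟫ +
          η s * (⟪u s x, FunctionSpaces.Torus.convect (u s) Ψ x⟫ +
            ν * ⟪u s x, FunctionSpaces.Torus.laplacian Ψ x⟫ + ⟪f s x, Ψ x⟫) := by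
      ext x
      rw [timeDeriv_smul hηd, convect_const_smul (u s) (hΨ.isContDiff (by simp)) (η s),
        laplacian_const_smul hΨ]
      simp only [real_inner_smul_right]
      ring
    rw [hpt, integral_add (i1.const_mul _) (i2.const_mul _), integral_const_mul,
      integral_const_mul]
  rw [integral_congr_ae hslice, hinit] at key
  exact key

/-! ### Slice bounds -/

omit [DecidableEq d] in
/-- `|∫⟪U, e⟫| ≤ ‖e‖·½(1 + ∫‖U‖²)` for `U ∈ L²(T^d)`. [folklore] -/
private theorem abs_integral_inner_const_le {U : UnitAddTorus d → EuclideanSpace ℝ d}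
    (hU : MemLp U 2 volume) (e : EuclideanSpace ℝ d) :
    |∫ x, ⟪U x, e⟫| ≤ ‖e‖ * (2⁻¹ * (1 + ∫ x, ‖U x‖ ^ 2)) :=
  (abs_integral_inner_le_of_norm_le (hU.integrable one_le_two) (fun _ => le_rfl)).trans
    (mul_le_mul_of_nonneg_left (integral_norm_le_of_memLp_two hU) (norm_nonneg _))

omit [DecidableEq d] in
/-- The spatial mean `s ↦ ∫⟪f(s), e⟫` of a `C([0,T];L²)` force is continuous on `[0,T]`. [folklore] -/
private theorem continuousOn_integral_inner_const {f : ℝ → UnitAddTorus d → EuclideanSpace ℝ d}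
    (hf : ContinuousInLpOn (Icc 0 T) 2 f) (e : EuclideanSpace ℝ d) :
    ContinuousOn (fun s => ∫ x, ⟪f s x, e⟫) (Icc 0 T) := by
  intro s₀ hs₀
  rw [ContinuousWithinAt, tendsto_iff_norm_sub_tendsto_zero]
  -- `‖F s − F s₀‖ ≤ ‖e‖ (eLpNorm (f s − f s₀) 1).toReal ≤ ‖e‖ (eLpNorm (f s − f s₀) 2).toReal → 0`
  have hlim : Tendsto (fun s => ‖e‖ * (eLpNorm (f s - f s₀) 2 volume).toReal) (𝓝[Icc 0 T] s₀) (𝓝 0) := by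
    have h1 : Tendsto (fun s => (eLpNorm (f s - f s₀) 2 volume).toReal) (𝓝[Icc 0 T] s₀) (𝓝 0) := by
      have h0 := (ENNReal.tendsto_toReal ENNReal.zero_ne_top).comp (hf.2 s₀ hs₀)
      rw [ENNReal.toReal_zero] at h0
      exact h0
    simpa using h1.const_mul ‖e‖
  refine squeeze_zero_norm' ?_ hlim
  filter_upwards [self_mem_nhdsWithin] with s hs
  have hfs : MemLp (f s) 2 volume := hf.1 s hs
  have hfs₀ : MemLp (f s₀) 2 volume := hf.1 s₀ hs₀
  have hdiff : MemLp (f s - f s₀) 2 volume := hfs.sub hfs₀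
  have i1 : Integrable (fun x => ⟪f s x, e⟫) volume :=
    FunctionSpaces.Torus.integrable_inner_of_continuous (hfs.integrable one_le_two) continuous_const
  have i2 : Integrable (fun x => ⟪f s₀ x, e⟫) volume :=
    FunctionSpaces.Torus.integrable_inner_of_continuous (hfs₀.integrable one_le_two) continuous_const
  rw [norm_norm, ← integral_sub i1 i2, Real.norm_eq_abs]
  have hsub : (fun x => ⟪f s x, e⟫ - ⟪f s₀ x, e⟫) = fun x => ⟪(f s - f s₀) x, e⟫ := by
    funext x; simp [inner_sub_left]
  rw [hsub]
  -- `|∫⟪g, e⟫| ≤ ‖e‖ ∫‖g‖ ≤ ‖e‖ ‖g‖_{L²}` on the probability torus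
  have h1 := abs_integral_inner_le_of_norm_le (hdiff.integrable one_le_two) (a := fun _ => e)
    (K := ‖e‖) (fun _ => le_rfl)
  refine h1.trans (mul_le_mul_of_nonneg_left ?_ (norm_nonneg _))
  have h2 : ∫ x, ‖(f s - f s₀) x‖ = (eLpNorm (f s - f s₀) 1 volume).toReal := by
    rw [eLpNorm_one_eq_lintegral_enorm, integral_norm_eq_lintegral_enorm hdiff.1]
  rw [h2]
  exact ENNReal.toReal_mono hdiff.eLpNorm_ne_top
    (eLpNorm_le_eLpNorm_of_exponent_le one_le_two hdiff.1)

/-! ### The momentum balance -/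

/-- **Momentum balance of forced weak solutions, a.e. in time** (Temam 1984, Ch. III §1.1 (1.25) with
Lemma 1.1, tested with constant fields; Galdi 2000, Lemma 2.1): for a forced weak solution on
`T^d × [0,T)` with `u ∈ L^∞(0,T;L²)` (a.e. slices in `L²`) and `f ∈ C([0,T];L²)`, and every constant
vector `e`, `∫⟪u(t), e⟫ = ∫⟪u₀, e⟫ + ∫_{(0,t]} ∫⟪f(s), e⟫ ds` for a.e. `t ∈ (0,T)`. The identity holds
only almost everywhere and only in this representative-free sense: the bare weak class fixes neither `u(t)`
on null sets of times nor `u(0)`. [cite: Temam1984, Ch. III §1.1 (1.25) and Lemma 1.1] -/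
theorem IsWeakNSSolutionForcedOn.integral_inner_const_eq_ae (hu : IsWeakNSSolutionForcedOn T ν f u₀ u)
    (hbound : ∃ C : ℝ≥0∞, C < ⊤ ∧ ∀ᵐ t ∂(volume.restrict (Ioo 0 T)), ∫⁻ x, ‖u t x‖ₑ ^ 2 ≤ C)
    (hL2 : ∀ᵐ s ∂(volume.restrict (Ioo 0 T)), MemLp (u s) 2 volume)
    (hf : ContinuousInLpOn (Icc 0 T) 2 f) (e : EuclideanSpace ℝ d) :
    ∀ᵐ t ∂(volume.restrict (Ioo 0 T)),
      ∫ x, ⟪u t x, e⟫ = (∫ x, ⟪u₀ x, e⟫) + ∫ s in Ioc 0 t, ∫ x, ⟪f s x, e⟫ := by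
  -- the constant test field
  set Ψ : UnitAddTorus d → EuclideanSpace ℝ d := fun _ => e with hΨ
  have hΨs : FunctionSpaces.Torus.IsSmooth Ψ := FunctionSpaces.Torus.isSmooth_const e
  have hΨdiv : FunctionSpaces.Torus.IsDivFree Ψ := isDivFree_constField e
  -- the flux reduces to the force pairing
  have hflux : ∀ s : ℝ, (∫ x, (⟪u s x, FunctionSpaces.Torus.convect (u s) Ψ x⟫ +
      ν * ⟪u s x, FunctionSpaces.Torus.laplacian Ψ x⟫ + ⟪f s x, Ψ x⟫)) = ∫ x, ⟪f s x, e⟫ := by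
    intro s
    refine integral_congr_ae (ae_of_all _ fun x => ?_)
    simp only [hΨ, convect_constField_zero, laplacian_constField_zero, inner_zero_right, mul_zero, zero_add]
  -- force slices are integrable (everywhere on `[0,T]`)
  have hfL1 : ∀ᵐ s ∂(volume.restrict (Ioo 0 T)), Integrable (f s) volume := by
    filter_upwards [ae_restrict_mem measurableSet_Ioo] with s hs
    exact (hf.1 s (Ioo_subset_Icc_self hs)).integrable one_le_two
  -- the tested identity for every admissible `η`
  have key : ∀ η : ℝ → ℝ, ContDiff ℝ ∞ η → HasCompactSupport η → tsupport η ⊆ Iio T →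
      (∫ s in Ioo 0 T, (deriv η s * (∫ x, ⟪u s x, e⟫) + η s * ∫ x, ⟪f s x, e⟫)) +
        η 0 * (∫ x, ⟪u₀ x, e⟫) = 0 := by
    intro η hη hηc hηT
    have h := hu.test_smul_ae hL2 hfL1 hΨs hΨdiv hη hηc hηT
    simp only [hflux] at h
    exact h
  -- integrability of the two time functions
  have huS : AEStronglyMeasurable (uncurry u) ((volume.restrict (Ioo 0 T)).prod volume) := by
    have h := FunctionSpaces.Torus.aestronglyMeasurable_uncurry_of_stLift_restrict hu.1
    rwa [Measure.volume_eq_prod, ← Measure.prod_restrict, Measure.restrict_univ] at h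
  have hUm : AEStronglyMeasurable (fun s => ∫ x, ⟪u s x, e⟫) (volume.restrict (Ioo 0 T)) := by
    have h1 : AEStronglyMeasurable (fun p : ℝ × UnitAddTorus d => ⟪uncurry u p, e⟫)
        ((volume.restrict (Ioo 0 T)).prod volume) :=
      huS.inner (aestronglyMeasurable_const (b := e))
    exact h1.integral_prod_right'
  obtain ⟨C, hCtop, hC⟩ := hbound
  have hU : IntegrableOn (fun s => ∫ x, ⟪u s x, e⟫) (Ioo 0 T) := by
    refine ⟨hUm, HasFiniteIntegral.of_bounded (C := ‖e‖ * (2⁻¹ * (1 + C.toReal))) ?_⟩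
    filter_upwards [hC, hL2] with s hs hus
    rw [Real.norm_eq_abs]
    refine (abs_integral_inner_const_le hus e).trans ?_
    have hreal : ∫ x, ‖u s x‖ ^ 2 ≤ C.toReal := by
      rw [Torus.lintegral_enorm_sq_eq_ofReal hus] at hs
      have := ENNReal.toReal_mono hCtop.ne hs
      rwa [ENNReal.toReal_ofReal (integral_nonneg fun x => sq_nonneg _)] at this
    gcongr
  have hF : IntegrableOn (fun s => ∫ x, ⟪f s x, e⟫) (Ioo 0 T) :=
    ((continuousOn_integral_inner_const hf e).integrableOn_Icc).mono_set Ioo_subset_Icc_self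
  exact FunctionSpaces.ae_eq_add_setIntegral_of_forall_test hU hF key

end Literature.Analysis.FluidPDE.Torus
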